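import Literature.Probability.Percolation.CornerPercolation
import Literature.Probability.Percolation.LatticeWalksGM
import Summits.CriticalPhenomena.CardyFormulaZ2.Theorems.CardySelfDualSegmentSegmentClosedStubGateTB
import HarnessLib

/-!
# Stub `stub_inscribedTB` of the line `Sketch` (crux `SegmentClosed`, stmt-CriticalPhenomena-5473,
# route `CardySelfDualSegment`)

The lower-bound bookkeeping of the confinement step of the line: a top–bottom open crossing of
an axis-parallel lattice box inscribed in a plane domain `Ω`, whose lowest rows are `2δ`-close to
the arc `A` and whose highest rows are `2δ`-close to the arc `B`, is a crude crossing
`embDomainCrossing squareLatticeEmbedding.z Ω δ A B` of `Ω` from `A` to `B` at mesh `δ`.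

Proof. The square lattice is drawn by `z v = √2 (v₀ + i v₁)` (`squareLatticeEmbedding_z`), so
after rescaling by `δ` the lattice rows sit at the Euclidean heights `s j`, `j ∈ ℤ`, `s = √2 δ`.
The given crossing of the translated box starts at a vertex of row `≤ y₁ / s` and ends at a
vertex of row `≥ y₂ / s`; clipping it (`exists_openConnIn_clip`: the row index moves by at most
one along an edge of `ℤ²`, `zdGraph_adj_apply_le`) between the first row strictly above the
height `y₁`, namely `⌊y₁ / s⌋ + 1`, and the last row strictly below `y₂`, namely `⌈y₂ / s⌉ - 1`
(in this order because `y₂ - y₁ ≥ 4δ ≥ 2 s`), leaves an open connection all of whose vertices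
have rescaled positions in `[x₁, x₂] × (y₁, y₂)`, hence in `Ω`; it starts at height in
`(y₁, y₁ + s] ⊆ (y₁, y₁ + 2δ]`, hence within `2δ` of `A`, and ends at height in
`[y₂ - s, y₂) ⊆ [y₂ - 2δ, y₂)`, hence within `2δ` of `B` (`openConnIn_mono`). The coordinate
book-keeping of the drawing (`gateTB_smul_re/_im`, `gateTB_sub_re/_im`) is shared with the
companion stub `stub_gateTB`. Elementary; no literature fact is used.
-/

noncomputable section

open Set Filter Metric MeasureTheory Complex
open scoped Topology
open Literature.Probability.RandomPlanarGeometry Literature.Probability.Percolation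
open Literature.Probability.LatticeModels

namespace Summit.CriticalPhenomena.CardyFormulaZ2.Cruxes.SegmentClosed.Sketch

/-- **Inscribed box.** If the closed-in-`re`, open-in-`im` box `[x₁, x₂] × (y₁, y₂)` lies in
`Ω`, its points of height in `(y₁, y₁ + 2δ]` are within `2δ` of `A` and its points of height in
`[y₂ - 2δ, y₂)` are within `2δ` of `B`, then a top–bottom crossing of the lattice box
`w + [0, a] × [0, b]`, `w = (x₁ + i y₁)/δ`, `a ≤ (x₂ - x₁)/δ`, `b ≥ (y₂ - y₁)/δ`, by
nearest-neighbour edges is a crude crossing of `Ω` from `A` to `B` at mesh `δ` (clip the walk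
at the first lattice row above `y₁/δ` and the last one below `y₂/δ`). -/
theorem stub_inscribedTB (Ω A B : Set ℂ) {δ x₁ x₂ y₁ y₂ a b : ℝ} (hδ : 0 < δ)
    (hΩ : ∀ p : ℂ, x₁ ≤ p.re → p.re ≤ x₂ → y₁ < p.im → p.im < y₂ → p ∈ Ω)
    (hA : ∀ p : ℂ, x₁ ≤ p.re → p.re ≤ x₂ → y₁ < p.im → p.im ≤ y₁ + 2 * δ → infDist p A ≤ 2 * δ)
    (hB : ∀ p : ℂ, x₁ ≤ p.re → p.re ≤ x₂ → y₂ - 2 * δ ≤ p.im → p.im < y₂ → infDist p B ≤ 2 * δ)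
    (hy : y₁ + 4 * δ ≤ y₂) (ha : 0 ≤ a) (hax : a ≤ (x₂ - x₁) / δ) (hb : (y₂ - y₁) / δ ≤ b)
    (ω : BondConfig (Site 2)) (hω : ω ⊆ (zdGraph 2).edgeSet)
    (h : ω ∈ embTBCrossing
      (fun v => squareLatticeEmbedding.z v - (((x₁ / δ : ℝ) : ℂ) + ((y₁ / δ : ℝ) : ℂ) * I)) a b) :
    ω ∈ embDomainCrossing squareLatticeEmbedding.z Ω δ A B := by
  -- `ha` belongs to the registered signature but is not needed for the inclusion
  have _ := ha
  -- the row spacing `s = √2 δ` of the rescaled lattice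
  obtain ⟨s, hs_def⟩ : ∃ s : ℝ, s = Real.sqrt 2 * δ := ⟨_, rfl⟩
  have hsqrt : (0 : ℝ) < Real.sqrt 2 := Real.sqrt_pos.2 (by norm_num)
  have hsqrt2 : Real.sqrt 2 ≤ 2 := (Real.sqrt_le_left (by norm_num)).2 (by norm_num)
  have hs : 0 < s := by rw [hs_def]; exact mul_pos hsqrt hδ
  have hs2 : s ≤ 2 * δ := by rw [hs_def]; exact mul_le_mul_of_nonneg_right hsqrt2 hδ.le
  -- Euclidean coordinates of the rescaled vertices
  have him : ∀ w : Site 2, ((δ : ℂ) * squareLatticeEmbedding.z w).im = (w 1 : ℝ) * s := by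
    intro w; rw [gateTB_smul_im, hs_def]; ring
  have hre : ∀ w : Site 2, Real.sqrt 2 * (w 0 : ℝ) - x₁ / δ ∈ Icc 0 a →
      x₁ ≤ ((δ : ℂ) * squareLatticeEmbedding.z w).re ∧
        ((δ : ℂ) * squareLatticeEmbedding.z w).re ≤ x₂ := by
    intro w hw
    rw [gateTB_smul_re]
    obtain ⟨h0, h1⟩ := hw
    have e1 : x₁ ≤ Real.sqrt 2 * (w 0 : ℝ) * δ := (div_le_iff₀ hδ).1 (by linarith)
    have e2 : x₁ / δ + (x₂ - x₁) / δ = x₂ / δ := by ring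
    have e3 : Real.sqrt 2 * (w 0 : ℝ) * δ ≤ x₂ := (le_div_iff₀ hδ).1 (by linarith)
    constructor <;> linarith
  -- the two clipping rows `⌊y₁ / s⌋ + 1` (first above `y₁`) and `⌈y₂ / s⌉ - 1` (last below `y₂`)
  have hfl : (⌊y₁ / s⌋ : ℝ) * s ≤ y₁ := (le_div_iff₀ hs).1 (Int.floor_le (y₁ / s))
  have hfl' : y₁ < ((⌊y₁ / s⌋ : ℝ) + 1) * s := (div_lt_iff₀ hs).1 (Int.lt_floor_add_one (y₁ / s))
  have hce : y₂ ≤ (⌈y₂ / s⌉ : ℝ) * s := (div_le_iff₀ hs).1 (Int.le_ceil (y₂ / s))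
  have hce' : ((⌈y₂ / s⌉ : ℝ) - 1) * s < y₂ :=
    (lt_div_iff₀ hs).1 (by linarith [Int.ceil_lt_add_one (y₂ / s)])
  have hj : ⌊y₁ / s⌋ + 1 ≤ ⌈y₂ / s⌉ - 1 := by
    have h1 : ((⌊y₁ / s⌋ : ℝ) + 2) * s ≤ (⌈y₂ / s⌉ : ℝ) * s := by linarith
    have h2 : (⌊y₁ / s⌋ : ℝ) + 2 ≤ ⌈y₂ / s⌉ := le_of_mul_le_mul_right h1 hs
    have h3 : ⌊y₁ / s⌋ + 2 ≤ ⌈y₂ / s⌉ := by exact_mod_cast h2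
    omega
  -- the endpoints of the given crossing lie below the first row and above the last one
  obtain ⟨u, hu, v, hv, huv⟩ := h
  simp only [mem_setOf_eq, gateTB_sub_im] at hu hv
  have hu' : u 1 ≤ ⌊y₁ / s⌋ + 1 := by
    have h1 : Real.sqrt 2 * (u 1 : ℝ) * δ ≤ y₁ := (le_div_iff₀ hδ).1 (by linarith)
    have h2 : (u 1 : ℝ) * s ≤ y₁ := by rw [hs_def]; linarith
    have h3 : u 1 ≤ ⌊y₁ / s⌋ := Int.le_floor.2 ((le_div_iff₀ hs).2 h2)
    omega
  have hv' : ⌈y₂ / s⌉ - 1 ≤ v 1 := by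
    have e : (y₂ - y₁) / δ + y₁ / δ = y₂ / δ := by ring
    have h1 : y₂ ≤ Real.sqrt 2 * (v 1 : ℝ) * δ := (div_le_iff₀ hδ).1 (by linarith)
    have h2 : y₂ ≤ (v 1 : ℝ) * s := by rw [hs_def]; linarith
    have h3 : ⌈y₂ / s⌉ ≤ v 1 := Int.ceil_le.2 ((div_le_iff₀ hs).2 h2)
    omega
  -- clip the open connection between the two rows
  obtain ⟨x', y', hx', hy', hconn⟩ := exists_openConnIn_clip hω (fun w : Site 2 => w 1)
    (fun p q hpq => (zdGraph_adj_apply_le hpq 1).1) hj hu' hv' huv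
  have hx'' : x' 1 = ⌊y₁ / s⌋ + 1 := hx'
  have hy'' : y' 1 = ⌈y₂ / s⌉ - 1 := hy'
  have hends := hconn
  obtain ⟨⟨⟨hx'S, -⟩, -, -⟩, ⟨⟨hy'S, -⟩, -, -⟩, -⟩ := hends
  simp only [gateTB_sub_re] at hx'S hy'S
  refine ⟨x', ?_, y', ?_, openConnIn_mono ?_ x' y' hconn⟩
  · -- the start is within `2δ` of `A`
    obtain ⟨h1, h2⟩ := hre x' hx'S
    have e : ((x' 1 : ℤ) : ℝ) = (⌊y₁ / s⌋ : ℝ) + 1 := by exact_mod_cast hx''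
    refine hA _ h1 h2 ?_ ?_ <;> rw [him, e]
    · exact hfl'
    · linarith
  · -- the end is within `2δ` of `B`
    obtain ⟨h1, h2⟩ := hre y' hy'S
    have e : ((y' 1 : ℤ) : ℝ) = (⌈y₂ / s⌉ : ℝ) - 1 := by exact_mod_cast hy''
    refine hB _ h1 h2 ?_ ?_ <;> rw [him, e]
    · linarith
    · exact hce'
  · -- every vertex of the clipped connection is drawn inside `[x₁, x₂] × (y₁, y₂) ⊆ Ω`
    rintro w ⟨⟨hwS, -⟩, hw1, hw2⟩
    simp only [gateTB_sub_re] at hwS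
    obtain ⟨h1, h2⟩ := hre w hwS
    have e1 : (⌊y₁ / s⌋ : ℝ) + 1 ≤ (w 1 : ℝ) := by exact_mod_cast hw1
    have e2 : (w 1 : ℝ) ≤ (⌈y₂ / s⌉ : ℝ) - 1 := by exact_mod_cast hw2
    refine hΩ _ h1 h2 ?_ ?_ <;> rw [him]
    · linarith [mul_le_mul_of_nonneg_right e1 hs.le]
    · linarith [mul_le_mul_of_nonneg_right e2 hs.le]

end Summit.CriticalPhenomena.CardyFormulaZ2.Cruxes.SegmentClosed.Sketch

end
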